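import Mathlib
import Summits.Schanuel.Schanuel.Theses.RigidCore
import Summits.Schanuel.Schanuel.Theorems.RigidCoreDefs
import Summits.Schanuel.Schanuel.Theorems.RigidCoreSchanuelOnLogFreeCoreSplitExact
import Summits.Schanuel.Schanuel.Theorems.AclSubsetLogFreeCore.Negative.LogFreeCoreCountable
import Literature.Barriers.Schanuel.AlgebraicIndependenceOfLogarithms
import Literature.NumberTheory.Transcendental.GammaFields
import Literature.NumberTheory.Transcendental.GammaFieldsEcl
import Literature.NumberTheory.Transcendental.GammaStrongDescent
import Literature.NumberTheory.Transcendental.ZilberFieldHomogeneity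

/-!
# Line `kernel-tower-relative-lw` (route `RigidCore`): vertical exactness, `(R) ⟹ RelLW_{m+1}`

Prover file for the registered stub `stub_relLWStep_of_crux` of line `kernel-tower-relative-lw`
of crux `stmt-Schanuel-0970` (`Summit.Schanuel.Schanuel.Theses.RigidCore.SchanuelOnLogFreeCore`,
"(R)": Schanuel's statement for `ℚ`-linearly independent tuples from the log-free core
`C_EA = sInf {K | 2πi ∈ K, K exp-closed, K relatively algebraically closed in ℂ}`).

The line reads `C_EA` through the kernel tower `L_m = stage m`
(`Theorems/AclSubsetLogFreeCore/Negative/LogFreeCoreObjects.lean`: `stage 0 = ℚ(2πi)^{ralg}`,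
`stage (m+1) = ℚ(L_m ∪ exp L_m)^{ralg}`, `C_EA = ⋃ₘ L_m`).  Its layer `RelLW_{m+1}` says:
exponentials of elements of `L_{m+1}` that are `ℚ`-linearly independent MODULO `L_m` are
algebraically independent OVER `L_{m+1}`.  This file proves the calibration

  **`(R) ⟹ RelLW_{m+1}` for every `m`**

(so, together with the level-`0` twin and the tower reduction in the skeleton, the line's normal
form `(R) ⟺ RelLW₀ ∧ ∀ m RelLW_{m+1}` is exact).  It is the exact analogue of the hull count
`SplitExact.stubB_of_crux` (`(R) ⟹` relative Schanuel of `C_EA` over the kernel-free core `M`,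
file `RigidCoreSchanuelOnLogFreeCoreSplitExact.lean`) with two changes: "independent modulo `M`"
becomes "independent modulo `stage m`", and the conclusion is over the BIGGER field
`K = stage (m+1)`; what makes it work is the LEVEL LEMMA: every element of `stage (m+1)` has a
hull INSIDE `stage m`.

Proof (predimension calculus of Γ-fields, `Literature.NumberTheory.Transcendental.GammaField`:
`δ = predim = td - ldim`, `gens V = V ∪ exp V`, `acl`, `algMatroid ℂ`; M. Bays, J. Kirby,
*Pseudo-exponential maps, variants, and quasiminimality*, Algebra & Number Theory 12 (2018),
arXiv:1512.04262, §9; J. Kirby, *Exponential algebraicity in exponential fields*, Bull. LMS 42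
(2010), arXiv:0810.4285, §3).  A HULL of `a` inside a `ℚ`-subspace `L ≤ C_EA` is a finitely
generated `V ≤ L` with `δ(V/0) = 0` and `a ∈ acl (gens V)`; the condition is always written out,
no definition is introduced.
* (R) gives `δ ≥ 0` on finitely generated subspaces of `C_EA` and `δ = 0` is closed under sums
  (`SplitExact.predim_bot_nonneg`, `SplitExact.predim_bot_sup_eq_zero`, imported); hence hulls
  inside `L` are `exp`-stable (`RelLWStep.exists_hull_exp`) and finitely many elements with hulls
  have a common hull (`RelLWStep.exists_common_hull`) — SplitExact's lemmas with `M` replaced by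
  an arbitrary `L ≤ C_EA`.
* Level `0`: the kernel line `ℚ·2πi ≤ stage 0` is a hull of every element of `stage 0`
  (`td ≤ 1` since `e^{2πi} = 1`, `δ ≤ 0`, and `δ ≥ 0` by (R);
  `RelLWStep.exists_hull_of_mem_stage_zero`).
* LEVEL LEMMA (`RelLWStep.exists_hull_of_mem_stage_succ`, induction on `m` through
  `RelLWStep.exists_hull_of_mem_stage`): `a ∈ stage (m+1)` is algebraic over
  `ℚ(stage m ∪ exp (stage m))`, hence over finitely many `c ∈ stage m` and `e^{c'}`,
  `c' ∈ stage m` (finite character of the algebraic matroid); hulls of the `c`, `c'` inside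
  `stage m` give hulls of the `e^{c'}` inside `stage m` and then one common hull of `a`.
* THE COUNT (`RelLWStep.le_trdeg_of_crux`, architecture of `SplitExact.stubB_of_crux`): for
  `u ⊂ K = stage (m+1)` independent modulo `stage m`, finite character gives a finite `c ⊂ K`
  such that `relRank(e^u / K) = trdeg_K K(e^u)` (`toENat_trdeg_adjoin_eq_relRank`) is still the
  relative rank over `J ∪ c` for a `K`-basis `J` of `e^u`; with `V ≤ stage m` a common hull of `c`:
  `r = ldim(u / stage m) ≤ ldim(u/V) ≤ td(u/V) ≤ relRank(u ∪ e^u / gens V) ≤ |J|`, and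
  `algebraicIndependent_of_le_trdeg_adjoin` finishes.
-/

noncomputable section

namespace Summit.Schanuel.Schanuel.Theorems.RigidCore

open Set Literature.NumberTheory.Transcendental Literature.NumberTheory.Transcendental.GammaField
open Summit.Schanuel.Schanuel.Theses.RigidCore (SchanuelOnLogFreeCore)
open Summit.Schanuel.Schanuel.Theorems.AclSubsetLogFreeCore.Negative
  (stage coreFamily logFreeCore logFreeCore_mem_coreFamily stage_le_succ exp_mem_stage_succ
    stage_le_of_mem mem_relAlg_iff two_pi_I_mem_stage_zero)

namespace RelLWStep

/-! ## The tower lies in `C_EA` -/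

/-- The crux's log-free core `C_EA = eaFibre (2πi)` (`RigidCoreDefs`) IS the tree's `logFreeCore`
(`LogFreeCoreObjects`): the two `sInf`s are syntactically the same. [folklore] -/
theorem eaFibre_eq_logFreeCore : eaFibre (2 * ↑Real.pi * Complex.I) = logFreeCore := rfl

/-- Every level `stage n` of the kernel tower lies in the log-free core `C_EA = eaFibre (2πi)`
(the core is a member of the family below each member of which the tower stays). [folklore] -/
theorem stage_le_eaFibre (n : ℕ) : stage n ≤ eaFibre (2 * ↑Real.pi * Complex.I) := by
  rw [eaFibre_eq_logFreeCore]
  exact stage_le_of_mem logFreeCore_mem_coreFamily n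

/-- `stage n ≤ C_EA` for the underlying `ℚ`-subspaces. [folklore] -/
theorem toSubmodule_stage_le (n : ℕ) :
    Subalgebra.toSubmodule (stage n).toSubalgebra ≤
      Subalgebra.toSubmodule (eaFibre (2 * ↑Real.pi * Complex.I)).toSubalgebra :=
  fun _ h => stage_le_eaFibre n h

/-! ## Hulls inside a subspace `L ≤ C_EA` -/

/-- Hulls inside `L` are `exp`-stable: for `a ∈ L` with a hull `V ≤ L`, the subspace
`V + ℚa ≤ L` is a hull of `eᵃ` (`td(a, eᵃ/V) ≤ 1 = ldim` gives `δ(ℚa/V) ≤ 0`, (R) gives `≥ 0`).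
SplitExact's `exists_hull_exp` with `M` replaced by `L`. [cite: BaysKirby2018ANT, §9] -/
theorem exists_hull_exp (hR : SchanuelOnLogFreeCore) {L : Submodule ℚ ℂ}
    (hLC : L ≤ Subalgebra.toSubmodule (eaFibre (2 * ↑Real.pi * Complex.I)).toSubalgebra)
    {a : ℂ} (haL : a ∈ L)
    (ha : ∃ V : Submodule ℚ ℂ, V ≤ L ∧ IsFG (⊥ : Submodule ℚ ℂ) V ∧ predim ⊥ V = 0 ∧
      a ∈ acl (gens V)) :
    ∃ V : Submodule ℚ ℂ, V ≤ L ∧ IsFG (⊥ : Submodule ℚ ℂ) V ∧ predim ⊥ V = 0 ∧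
      Complex.exp a ∈ acl (gens V) := by
  obtain ⟨V, hV, hVfg, hV0, haV⟩ := ha
  have hV'L : V ⊔ Submodule.span ℚ {a} ≤ L :=
    sup_le hV ((Submodule.span_singleton_le_iff_mem _ _).2 haL)
  have hV'fg : IsFG (⊥ : Submodule ℚ ℂ) (V ⊔ Submodule.span ℚ {a}) :=
    hVfg.sup (isFG_span_of_finite ⊥ (finite_singleton a))
  have htd : td V (Submodule.span ℚ {a}) ≤ 1 := by
    rw [td_span_singleton, (algMatroid ℂ).relRank_insert_eq_of_mem_closure
      ((algMatroid ℂ).closure_subset_closure subset_union_right haV)]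
    exact ((algMatroid ℂ).relRank_le_encard_diff _ _).trans
      ((encard_le_encard sdiff_subset).trans (encard_singleton _).le)
  have hge := SplitExact.predim_bot_nonneg hR (hV'L.trans hLC) hV'fg
  rw [predim_add bot_le le_sup_left hV'fg, predim_sup_left, hV0, zero_add] at hge
  refine ⟨_, hV'L, hV'fg, ?_, subset_acl _
    (exp_mem_gens (Submodule.mem_sup_right (Submodule.mem_span_singleton_self a)))⟩
  rw [predim_add bot_le le_sup_left hV'fg, predim_sup_left, hV0, zero_add]
  exact le_antisymm (predim_span_singleton_nonpos_of_td_le_one htd) hge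

/-- A finite set of elements with hulls inside `L` has a common hull inside `L` (sum of the
hulls, `δ = 0` by `SplitExact.predim_bot_sup_eq_zero`). [cite: BaysKirby2018ANT, §9] -/
theorem exists_common_hull (hR : SchanuelOnLogFreeCore) {L : Submodule ℚ ℂ}
    (hLC : L ≤ Subalgebra.toSubmodule (eaFibre (2 * ↑Real.pi * Complex.I)).toSubalgebra)
    {s : Set ℂ} (hs : s.Finite)
    (hsub : ∀ c ∈ s, ∃ V : Submodule ℚ ℂ, V ≤ L ∧ IsFG (⊥ : Submodule ℚ ℂ) V ∧
      predim ⊥ V = 0 ∧ c ∈ acl (gens V)) :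
    ∃ V : Submodule ℚ ℂ, V ≤ L ∧ IsFG (⊥ : Submodule ℚ ℂ) V ∧ predim ⊥ V = 0 ∧
      s ⊆ acl (gens V) := by
  induction s, hs using Set.Finite.induction_on with
  | empty => exact ⟨⊥, bot_le, isFG_self ⊥, predim_self ⊥, empty_subset _⟩
  | insert _ _ ih =>
    obtain ⟨W, hW, hWfg, hW0, hsW⟩ := ih fun c hc => hsub c (mem_insert_of_mem _ hc)
    obtain ⟨V, hV, hVfg, hV0, haV⟩ := hsub _ (mem_insert _ _)
    exact ⟨V ⊔ W, sup_le hV hW, hVfg.sup hWfg,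
      SplitExact.predim_bot_sup_eq_zero hR (hV.trans hLC) (hW.trans hLC) hVfg hWfg hV0 hW0,
      insert_subset (acl_mono (gens_mono le_sup_left) haV)
        (hsW.trans (acl_mono (gens_mono le_sup_right)))⟩

/-! ## Hulls inside the levels of the tower -/

/-- Level `0`: the kernel line `ℚ·2πi ≤ stage 0` is a hull of every element of
`stage 0 = ℚ(2πi)^{ralg}` (`td(2πi, e^{2πi}/0) ≤ 1` since `e^{2πi} = 1`, so `δ ≤ 0`; `δ ≥ 0`
by (R)). [folklore] -/
theorem exists_hull_of_mem_stage_zero (hR : SchanuelOnLogFreeCore) {a : ℂ} (ha : a ∈ stage 0) :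
    ∃ V : Submodule ℚ ℂ, V ≤ Subalgebra.toSubmodule (stage 0).toSubalgebra ∧
      IsFG (⊥ : Submodule ℚ ℂ) V ∧ predim ⊥ V = 0 ∧ a ∈ acl (gens V) := by
  set τ : ℂ := 2 * ↑Real.pi * Complex.I with hτ
  have hVL : Submodule.span ℚ {τ} ≤ Subalgebra.toSubmodule (stage 0).toSubalgebra :=
    (Submodule.span_singleton_le_iff_mem _ _).2 two_pi_I_mem_stage_zero
  have hVfg : IsFG (⊥ : Submodule ℚ ℂ) (Submodule.span ℚ {τ}) :=
    isFG_span_of_finite ⊥ (finite_singleton τ)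
  have hexp : (Literature.ModelTheory.ExponentialFields.ExponentialRing.exp τ : ℂ) = 1 := by
    show Complex.exp τ = 1
    rw [hτ]
    exact Complex.exp_two_pi_mul_I
  have htd : td ⊥ (Submodule.span ℚ {τ}) ≤ 1 := by
    rw [td_span_singleton, pair_comm, hexp,
      (algMatroid ℂ).relRank_insert_eq_of_mem_closure (one_mem_acl _)]
    exact ((algMatroid ℂ).relRank_le_encard_diff _ _).trans
      ((encard_le_encard sdiff_subset).trans (encard_singleton _).le)
  refine ⟨Submodule.span ℚ {τ}, hVL, hVfg,
    le_antisymm (predim_span_singleton_nonpos_of_td_le_one htd)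
      (SplitExact.predim_bot_nonneg hR (hVL.trans (toSubmodule_stage_le 0)) hVfg), ?_⟩
  have ha' : IsAlgebraic (IntermediateField.adjoin ℚ {τ}) a := mem_relAlg_iff.1 ha
  have ha'' : a ∈ acl ((IntermediateField.adjoin ℚ {τ} : IntermediateField ℚ ℂ) : Set ℂ) := by
    rw [mem_acl_iff, ← IntermediateField.coe_toSubalgebra, Algebra.adjoin_eq]
    exact ha'
  rw [acl_adjoin] at ha''
  exact acl_mono (singleton_subset_iff.2
    (mem_gens_of_mem (Submodule.mem_span_singleton_self τ))) ha''

/-- Induction step of the level lemma: if every element of `stage m` has a hull inside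
`stage m`, then so does every element of `stage (m+1)` — it is algebraic over finitely many
`c ∈ stage m` and `e^{c'}`, `c' ∈ stage m` (finite character of the algebraic matroid), whose
hulls inside `stage m` (`exists_hull_exp` for the exponentials) have a common hull.
[cite: Kirby2010, §3] -/
theorem exists_hull_of_mem_stage_succ_aux (hR : SchanuelOnLogFreeCore) (m : ℕ)
    (ih : ∀ c ∈ stage m, ∃ V : Submodule ℚ ℂ, V ≤ Subalgebra.toSubmodule (stage m).toSubalgebra ∧
      IsFG (⊥ : Submodule ℚ ℂ) V ∧ predim ⊥ V = 0 ∧ c ∈ acl (gens V))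
    {a : ℂ} (ha : a ∈ stage (m + 1)) :
    ∃ V : Submodule ℚ ℂ, V ≤ Subalgebra.toSubmodule (stage m).toSubalgebra ∧
      IsFG (⊥ : Submodule ℚ ℂ) V ∧ predim ⊥ V = 0 ∧ a ∈ acl (gens V) := by
  have ha' : IsAlgebraic (IntermediateField.adjoin ℚ
      ((stage m : Set ℂ) ∪ Complex.exp '' (stage m : Set ℂ))) a :=
    mem_relAlg_iff.1 ha
  have ha'' : a ∈ acl ((stage m : Set ℂ) ∪ Complex.exp '' (stage m : Set ℂ)) := by
    rw [← acl_adjoin, mem_acl_iff, ← IntermediateField.coe_toSubalgebra, Algebra.adjoin_eq]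
    exact ha'
  obtain ⟨I, hIsub, hIfin, -, haI⟩ :=
    (algMatroid ℂ).exists_mem_finite_closure_of_mem_closure ha''
  obtain ⟨V, hV, hVfg, hV0, hIV⟩ := exists_common_hull hR (toSubmodule_stage_le m) hIfin
    fun c hc => by
      rcases hIsub hc with hcm | ⟨c', hc', rfl⟩
      · exact ih c hcm
      · exact exists_hull_exp hR (toSubmodule_stage_le m) hc' (ih c' hc')
  exact ⟨V, hV, hVfg, hV0, acl_subset_acl_of_subset hIV haI⟩

/-- Every element of `stage m` has a hull inside `stage m` (induction on `m`: level `0` by the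
kernel line, level `m+1` by the induction step and `stage m ≤ stage (m+1)`).
[cite: Kirby2010, §3] -/
theorem exists_hull_of_mem_stage (hR : SchanuelOnLogFreeCore) :
    ∀ (m : ℕ) {a : ℂ}, a ∈ stage m →
      ∃ V : Submodule ℚ ℂ, V ≤ Subalgebra.toSubmodule (stage m).toSubalgebra ∧
        IsFG (⊥ : Submodule ℚ ℂ) V ∧ predim ⊥ V = 0 ∧ a ∈ acl (gens V)
  | 0, _, ha => exists_hull_of_mem_stage_zero hR ha
  | m + 1, _, ha => by
    obtain ⟨V, hV, hVfg, hV0, haV⟩ :=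
      exists_hull_of_mem_stage_succ_aux hR m (fun c hc => exists_hull_of_mem_stage hR m hc) ha
    exact ⟨V, hV.trans fun x hx => stage_le_succ m hx, hVfg, hV0, haV⟩

/-- **Level lemma**: every element of `stage (m+1)` has a hull INSIDE `stage m` — a finitely
generated `ℚ`-subspace `V ≤ stage m` with `δ(V/0) = 0` over whose Γ-field `ℚ(V, e^V)` it is
algebraic. [cite: Kirby2010, §3] -/
theorem exists_hull_of_mem_stage_succ (hR : SchanuelOnLogFreeCore) (m : ℕ) {a : ℂ}
    (ha : a ∈ stage (m + 1)) :
    ∃ V : Submodule ℚ ℂ, V ≤ Subalgebra.toSubmodule (stage m).toSubalgebra ∧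
      IsFG (⊥ : Submodule ℚ ℂ) V ∧ predim ⊥ V = 0 ∧ a ∈ acl (gens V) :=
  exists_hull_of_mem_stage_succ_aux hR m (fun _ hc => exists_hull_of_mem_stage hR m hc) ha

/-! ## The count -/

/-- **`(R) ⟹ RelLW_{m+1}`, transcendence-degree form**: for `u ⊂ K = stage (m+1)` independent
modulo `stage m`, `r ≤ trdeg_K K(e^u)`.  Hull count: with `J` a `K`-basis of `e^u` in the
algebraic matroid, a finite `c ⊂ K` with `u ∪ e^u ⊆ acl (J ∪ c)` (finite character) and a
common hull `V ≤ stage m` of `c` (level lemma),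
`r = ldim(u / stage m) ≤ ldim(u/V) ≤ td(u/V) ≤ relRank(u ∪ e^u / gens V) ≤ |J| = trdeg_K K(e^u)`.
[cite: BaysKirby2018ANT, §9] -/
theorem le_trdeg_of_crux (hR : SchanuelOnLogFreeCore) (m r : ℕ) (u : Fin r → ℂ)
    (hu : ∀ i, u i ∈ stage (m + 1))
    (hli : LinearIndependent ℚ ((Submodule.span ℚ (stage m : Set ℂ)).mkQ ∘ u)) :
    (r : Cardinal) ≤ Algebra.trdeg (stage (m + 1))
      ↥(IntermediateField.adjoin (stage (m + 1)) (range fun i => Complex.exp (u i))) := by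
  set K : IntermediateField ℚ ℂ := stage (m + 1) with hK
  set S : Set ℂ := range fun i => Complex.exp (u i) with hS
  set T : Set ℂ := range u ∪ range (Complex.exp ∘ u) with hT
  set X : Submodule ℚ ℂ := Submodule.span ℚ (range u) with hX
  have hTfin : T.Finite := (finite_range u).union (finite_range _)
  -- (1) finite character: a basis `J` of `S` over `K` and a finite `I ⊆ J ∪ K` spanning `T`
  obtain ⟨J, hJ⟩ := ((algMatroid ℂ).contract (K : Set ℂ)).exists_isBasis' S
  have hρ : (algMatroid ℂ).relRank (K : Set ℂ) S = J.encard := by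
    rw [Matroid.relRank_eq_eRk_contract, hJ.encard_eq_eRk]
  have hSclJ : S ⊆ (algMatroid ℂ).closure (J ∪ (K : Set ℂ)) := fun a haS => by
    by_cases haM : a ∈ (K : Set ℂ)
    · exact (algMatroid ℂ).subset_closure _ (fun _ _ => mem_univ _) (Or.inr haM)
    · have haE : a ∈ ((algMatroid ℂ).contract (K : Set ℂ)).E := by
        rw [Matroid.contract_ground]; exact ⟨mem_univ a, haM⟩
      have h1 := ((algMatroid ℂ).contract (K : Set ℂ)).inter_ground_subset_closure
        S ⟨haS, haE⟩
      rw [← hJ.closure_eq_closure, Matroid.contract_closure_eq] at h1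
      exact h1.1
  have hTclJ : T ⊆ (algMatroid ℂ).closure (J ∪ (K : Set ℂ)) := by
    rintro a (⟨i, rfl⟩ | ⟨i, rfl⟩)
    · exact (algMatroid ℂ).subset_closure _ (fun _ _ => mem_univ _) (Or.inr (hu i))
    · exact hSclJ ⟨i, rfl⟩
  obtain ⟨I, hIJK, hIfin, -, hTI⟩ :=
    (algMatroid ℂ).exists_subset_finite_closure_of_subset_closure hTfin hTclJ
  -- (2) a common hull `V ≤ stage m` of the finitely many elements of `K` in `I` (level lemma)
  obtain ⟨V, hV, hVfg, hV0, hcV⟩ := exists_common_hull hR (toSubmodule_stage_le m)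
    (hIfin.inter_of_left (K : Set ℂ)) fun a ha => exists_hull_of_mem_stage_succ hR m ha.2
  -- (3) over `gens V` the set `T` has relative rank `≤ |J| = relRank (S / K)`
  have hle1 : (algMatroid ℂ).relRank (gens V) T ≤ J.encard := by
    have hTcl : T ⊆ (algMatroid ℂ).closure (J ∪ gens V) := by
      refine hTI.trans ((algMatroid ℂ).closure_subset_closure_of_subset_closure fun a ha => ?_)
      rcases hIJK ha with haJ | haK
      · exact (algMatroid ℂ).subset_closure (J ∪ gens V) (fun _ _ => mem_univ _) (Or.inl haJ)
      · exact (algMatroid ℂ).closure_subset_closure subset_union_right (hcV ⟨ha, haK⟩)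
    calc (algMatroid ℂ).relRank (gens V) T ≤ (algMatroid ℂ).relRank (gens V) J :=
          (algMatroid ℂ).relRank_le_of_subset_closure _ hTcl
      _ ≤ (J \ gens V).encard := (algMatroid ℂ).relRank_le_encard_diff _ _
      _ ≤ J.encard := encard_le_encard sdiff_subset
  -- (4) `td(X/V) ≤ relRank (T / gens V)`; (5) `δ(X/V) ≥ 0`; (6) `ldim(X/V) ≥ ldim(X/stage m) = r`
  have htdle : td V X ≤ (algMatroid ℂ).relRank (gens V) T := by
    have h := td_span_le_relRank V (range u)
    rw [← range_comp] at h
    exact h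
  have hXC : X ≤ Subalgebra.toSubmodule (eaFibre (2 * ↑Real.pi * Complex.I)).toSubalgebra :=
    Submodule.span_le.2 (range_subset_iff.2 fun i => stage_le_eaFibre (m + 1) (hu i))
  have hXfg : IsFG (⊥ : Submodule ℚ ℂ) X := isFG_span_of_finite ⊥ (finite_range u)
  have hVXfg : IsFG (⊥ : Submodule ℚ ℂ) (V ⊔ X) := hVfg.sup hXfg
  have hpVX := SplitExact.predim_bot_nonneg hR
    (sup_le (hV.trans (toSubmodule_stage_le m)) hXC) hVXfg
  rw [predim_add bot_le le_sup_left hVXfg, predim_sup_left, hV0, zero_add, predim_def] at hpVX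
  have hldimM : ldim (Submodule.span ℚ (stage m : Set ℂ)) X = r := by
    rw [ldim, hX, Submodule.map_span, ← range_comp, finrank_span_eq_card hli, Fintype.card_fin]
  have hldim : r ≤ ldim V X := by
    have hVM : V ≤ Submodule.span ℚ (stage m : Set ℂ) :=
      fun v hv => Submodule.subset_span (hV hv)
    have h := ldim_add (inf_le_inf_left X hVM) inf_le_left (hXfg.of_le_left bot_le)
    rw [← ldim_eq_ldim_inf X V, ← ldim_eq_ldim_inf X, hldimM] at h
    omega
  -- (7) `r ≤ ldim(X/V) ≤ td(X/V) ≤ relRank (T / gens V) ≤ |J| = relRank (S / K) = trdeg_K K(S)`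
  refine Cardinal.natCast_le_toENat.1 ?_
  rw [toENat_trdeg_adjoin_eq_relRank K S, hρ]
  calc (r : ℕ∞) ≤ ((td V X).toNat : ℕ∞) := ENat.coe_le_coe.2 (by omega)
    _ = td V X := ENat.coe_toNat (td_ne_top (hXfg.of_le_left bot_le))
    _ ≤ J.encard := htdle.trans hle1

end RelLWStep

/-- **Registered stub `stub_relLWStep_of_crux` of line `kernel-tower-relative-lw` — vertical
exactness up the tower: `(R) ⟹ RelLW_{m+1}` for every `m`** (signature verbatim).  Under
Schanuel's statement on the log-free core, exponentials of elements of `stage (m+1)` that are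
`ℚ`-linearly independent modulo `stage m` are algebraically independent over `stage (m+1)`:
`RelLWStep.le_trdeg_of_crux` (hull count through the level lemma) and
`algebraicIndependent_of_le_trdeg_adjoin`. [cite: BaysKirby2018ANT, §9] -/
theorem stub_relLWStep_of_crux :
    Summit.Schanuel.Schanuel.Theses.RigidCore.SchanuelOnLogFreeCore →
      ∀ (m r : ℕ) (u : Fin r → ℂ), (∀ i, u i ∈ stage (m + 1)) →
        LinearIndependent ℚ ((Submodule.span ℚ (stage m : Set ℂ)).mkQ ∘ u) →
          AlgebraicIndependent (↥(stage (m + 1))) (fun i => Complex.exp (u i)) :=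
  fun hR m _ u hu hli =>
    Literature.Barriers.Schanuel.algebraicIndependent_of_le_trdeg_adjoin
      (K := ↥(stage (m + 1))) (fun i => Complex.exp (u i))
      (RelLWStep.le_trdeg_of_crux hR m _ u hu hli)

end Summit.Schanuel.Schanuel.Theorems.RigidCore

end
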